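import Summits.QuantumFields.QCD.Theses.QuarksAsStableAction
import Literature.MathematicalPhysics.QuantumLattice.WilsonDiracAP
import Literature.MathematicalPhysics.QuantumFieldTheory.WilsonSiteRPForm
import Mathlib
import HarnessLib

/-!
# Assembly of the unquenched chessboard bound, part 1: measure plumbing and the RP form
(stub `stub_assembly` of crux stmt-QuantumFields-9735, line Sketch; auxiliary file 1)

* Wilson-measure integrals as product-Haar integrals with density `e^{-β S_W}` (the normalisation
  `Z_g⁻¹` is a common scalar), change of variables under torus translations and under the site
  reflection `Θ'` (`GaugeConfig.negReflect`);
* the sesquilinear form `B(G, F) = ∫ conj G(Θ'U) F(U) W(U) dHaar` of a bounded measurable real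
  `Θ'`-invariant weight `W`: Hermitian symmetry, expansion, and the Cauchy–Schwarz inequality from
  positivity on half-observables (`WilsonSiteRP.IsHalfObs`), copying the pattern of
  `WilsonSiteRP.normSq_siteRPForm_le`;
* the signed det-weighted Wilson density `W(U) = ∏_f det D_AP[U, m_f] e^{-β S_W(U)}` of `SU(3)`:
  continuity, reality, `Θ'`- and translation invariance.

All statements here are proved; no definitions are introduced (the objects are written inline).
-/

noncomputable section

open MeasureTheory Matrix Complex Finset
open Literature.MathematicalPhysics.QuantumFieldTheory Literature.MathematicalPhysics.QuantumLattice
open scoped ComplexConjugate BigOperators ComplexOrder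

namespace Summit.QuantumFields.QCD.Theorems.UnquenchedChessboardBoundLine

section Generic

variable {L N : ℕ} [NeZero L]
variable {G : Type*} [Group G] [TopologicalSpace G] [IsTopologicalGroup G] [CompactSpace G]
  [MeasurableSpace G] [BorelSpace G]
variable (ρ : G →* Matrix (Fin N) (Fin N) ℂ)

/-! ## Product Haar measure: translations and the site reflection -/

omit [TopologicalSpace G] [IsTopologicalGroup G] [CompactSpace G] [BorelSpace G] [Group G] in
/-- Torus translations preserve the product Haar measure. -/
theorem asm_measurePreserving_torusConfigShift_pi (μ₀ : Measure G) [IsProbabilityMeasure μ₀]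
    (v : Site 4 L) :
    MeasurePreserving (torusConfigShift (G := G) v) (Measure.pi fun _ : Edge 4 L => μ₀)
      (Measure.pi fun _ : Edge 4 L => μ₀) :=
  measurePreserving_arrowCongr' (fun _ : Edge 4 L => μ₀) (fun _ : Edge 4 L => μ₀)
    (torusEdgeShift v) (MeasurableEquiv.refl G) fun _ => MeasurePreserving.id _

omit [TopologicalSpace G] [IsTopologicalGroup G] [CompactSpace G] [BorelSpace G] [Group G] in
/-- Change of variables under a translation. -/
theorem asm_integral_comp_torusConfigShift_pi (μ₀ : Measure G) [IsProbabilityMeasure μ₀]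
    (v : Site 4 L) (g : GaugeConfig 4 L G → ℂ) :
    ∫ U, g (torusConfigShift v U) ∂(Measure.pi fun _ : Edge 4 L => μ₀) =
      ∫ U, g U ∂(Measure.pi fun _ : Edge 4 L => μ₀) :=
  (asm_measurePreserving_torusConfigShift_pi μ₀ v).integral_comp (torusConfigShift v).measurableEmbedding g

/-- Change of variables under `Θ'`. -/
theorem asm_integral_comp_negReflect_pi (g : GaugeConfig 4 L G → ℂ) :
    ∫ U, g (GaugeConfig.negReflect U) ∂(Measure.pi fun _ : Edge 4 L => haarProbability G) =
      ∫ U, g U ∂(Measure.pi fun _ : Edge 4 L => haarProbability G) :=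
  (WilsonSiteRP.measurePreserving_negReflect (d := 4) (L := L) (G := G)).integral_comp
    (WilsonSiteRP.negReflectEquiv (d := 4) (L := L) (G := G)).measurableEmbedding g

/-! ## Wilson-measure integrals as weighted Haar integrals -/

/-- `∫ f dμ_W = Z_g⁻¹ ∫ e^{-β S_W} f dHaar`. -/
theorem asm_integral_wilsonMeasure_eq (hρ : Continuous ρ) (β : ℝ) (f : GaugeConfig 4 L G → ℂ) :
    ∫ U, f U ∂(wilsonMeasure ρ β) =
      (((partitionFunction (d := 4) (L := L) ρ β)⁻¹).toReal : ℂ) *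
        ∫ U, (Real.exp (-β * wilsonAction ρ U) : ℂ) * f U
          ∂(Measure.pi fun _ : Edge 4 L => haarProbability G) := by
  have hdens : Measurable fun U : GaugeConfig 4 L G =>
      ENNReal.ofReal (Real.exp (-β * wilsonAction ρ U)) :=
    ENNReal.measurable_ofReal.comp ((WilsonRP.measurable_wilsonAction ρ hρ).const_mul (-β)).exp
  unfold wilsonMeasure
  rw [integral_smul_measure]
  unfold wilsonWeight
  rw [integral_withDensity_eq_integral_toReal_smul hdens (ae_of_all _ fun _ => ENNReal.ofReal_lt_top)]
  simp_rw [ENNReal.toReal_ofReal (Real.exp_nonneg _), Complex.real_smul]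

/-- `∫_A f dμ_W = Z_g⁻¹ ∫ e^{-β S_W} 1_A f dHaar` for a measurable event `A`. -/
theorem asm_setIntegral_wilsonMeasure_eq (hρ : Continuous ρ) (β : ℝ) (f : GaugeConfig 4 L G → ℂ)
    {A : Set (GaugeConfig 4 L G)} (hA : MeasurableSet A) :
    ∫ U in A, f U ∂(wilsonMeasure ρ β) =
      (((partitionFunction (d := 4) (L := L) ρ β)⁻¹).toReal : ℂ) *
        ∫ U, (Real.exp (-β * wilsonAction ρ U) : ℂ) * A.indicator f U
          ∂(Measure.pi fun _ : Edge 4 L => haarProbability G) := by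
  rw [← integral_indicator hA, asm_integral_wilsonMeasure_eq ρ hρ]

omit [NeZero L] in
/-- The elementary ratio estimate: if `‖A‖ ≤ Re Z · B` with `Z` real and `Re Z > 0`, then
`‖(k A)/(k Z)‖ ≤ B` for every scalar `k` (junk value `0` when `k = 0`). -/
theorem asm_norm_div_le_of_le {A Z k : ℂ} {B : ℝ} (hB : 0 ≤ B) (hZ : 0 < Z.re) (hZim : Z.im = 0)
    (h : ‖A‖ ≤ Z.re * B) : ‖(k * A) / (k * Z)‖ ≤ B := by
  by_cases hk : k = 0
  · rw [hk, zero_mul, zero_mul, div_zero, norm_zero]; exact hB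
  rw [mul_div_mul_left _ _ hk, norm_div]
  have hnZ : ‖Z‖ = Z.re := by
    rw [← Complex.re_add_im Z, hZim]; simp [abs_of_pos hZ]
  rw [hnZ, div_le_iff₀ hZ]
  linarith [mul_comm Z.re B]

/-! ## The reflection-positivity form of a real `Θ'`-invariant weight -/

/-- Integrability of `conj G(Θ'U) F(U) W(U)` for bounded measurable `G`, `F`, `W`. -/
theorem asm_integrable_rpIntegrand {W : GaugeConfig 4 L G → ℂ} (hWm : Measurable W)
    (hWb : ∃ C, ∀ U, ‖W U‖ ≤ C) {F₁ F₂ : GaugeConfig 4 L G → ℂ}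
    (h₁ : WilsonSiteRP.IsHalfObs F₁) (h₂ : WilsonSiteRP.IsHalfObs F₂) :
    Integrable (fun U => conj (F₁ (GaugeConfig.negReflect U)) * F₂ U * W U)
      (Measure.pi fun _ : Edge 4 L => haarProbability G) := by
  obtain ⟨C₁, hC₁⟩ := h₁.bounded
  obtain ⟨C₂, hC₂⟩ := h₂.bounded
  obtain ⟨CW, hCW⟩ := hWb
  refine Integrable.of_bound (((Complex.continuous_conj.measurable.comp
    (h₁.measurable.comp WilsonSiteRP.measurable_negReflect)).mul h₂.measurable).mul
    hWm).aestronglyMeasurable (C₁ * C₂ * CW) (ae_of_all _ fun U => ?_)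
  rw [norm_mul, norm_mul, Complex.norm_conj]
  have h0 : 0 ≤ C₁ := (norm_nonneg _).trans (hC₁ U)
  have h1 : 0 ≤ C₂ := (norm_nonneg _).trans (hC₂ U)
  exact mul_le_mul (mul_le_mul (hC₁ _) (hC₂ _) (norm_nonneg _) h0) (hCW _) (norm_nonneg _)
    (mul_nonneg h0 h1)

/-- **Hermitian symmetry** `B(F₂, F₁) = conj B(F₁, F₂)` for a real `Θ'`-invariant weight. -/
theorem asm_rpForm_conj_symm {W : GaugeConfig 4 L G → ℂ} (hWr : ∀ U, conj (W U) = W U)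
    (hWΘ : ∀ U, W (GaugeConfig.negReflect U) = W U) (F₁ F₂ : GaugeConfig 4 L G → ℂ) :
    ∫ U, conj (F₂ (GaugeConfig.negReflect U)) * F₁ U * W U ∂(Measure.pi fun _ : Edge 4 L => haarProbability G) =
      conj (∫ U, conj (F₁ (GaugeConfig.negReflect U)) * F₂ U * W U
        ∂(Measure.pi fun _ : Edge 4 L => haarProbability G)) := by
  rw [← integral_conj]
  simp only [map_mul, Complex.conj_conj, hWr]
  rw [← asm_integral_comp_negReflect_pi (fun U => conj (F₂ (GaugeConfig.negReflect U)) * F₁ U * W U)]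
  refine integral_congr_ae (ae_of_all _ fun U => ?_)
  simp only [WilsonSiteRP.negReflect_negReflect_config, hWΘ]
  ring

/-- **Expansion** of `B(F₁ + t F₂, F₁ + t F₂)`. -/
theorem asm_rpForm_add_smul {W : GaugeConfig 4 L G → ℂ} (hWm : Measurable W)
    (hWb : ∃ C, ∀ U, ‖W U‖ ≤ C) {F₁ F₂ : GaugeConfig 4 L G → ℂ}
    (h₁ : WilsonSiteRP.IsHalfObs F₁) (h₂ : WilsonSiteRP.IsHalfObs F₂) (t : ℂ) :
    ∫ U, conj (F₁ (GaugeConfig.negReflect U) + t * F₂ (GaugeConfig.negReflect U)) * (F₁ U + t * F₂ U) * W U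
        ∂(Measure.pi fun _ : Edge 4 L => haarProbability G) =
      ∫ U, conj (F₁ (GaugeConfig.negReflect U)) * F₁ U * W U ∂(Measure.pi fun _ : Edge 4 L => haarProbability G) +
      t * ∫ U, conj (F₁ (GaugeConfig.negReflect U)) * F₂ U * W U ∂(Measure.pi fun _ : Edge 4 L => haarProbability G) +
      conj t * ∫ U, conj (F₂ (GaugeConfig.negReflect U)) * F₁ U * W U
        ∂(Measure.pi fun _ : Edge 4 L => haarProbability G) +
      conj t * t * ∫ U, conj (F₂ (GaugeConfig.negReflect U)) * F₂ U * W U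
        ∂(Measure.pi fun _ : Edge 4 L => haarProbability G) := by
  set μ : Measure (GaugeConfig 4 L G) := Measure.pi fun _ : Edge 4 L => haarProbability G
  have i11 := asm_integrable_rpIntegrand hWm hWb h₁ h₁
  have i12 := asm_integrable_rpIntegrand hWm hWb h₁ h₂
  have i21 := asm_integrable_rpIntegrand hWm hWb h₂ h₁
  have i22 := asm_integrable_rpIntegrand hWm hWb h₂ h₂
  have iA : Integrable (fun U => conj (F₁ (GaugeConfig.negReflect U)) * F₁ U * W U +
      t * (conj (F₁ (GaugeConfig.negReflect U)) * F₂ U * W U)) μ := i11.add (i12.const_mul t)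
  have iB : Integrable (fun U => conj t * (conj (F₂ (GaugeConfig.negReflect U)) * F₁ U * W U) +
      conj t * t * (conj (F₂ (GaugeConfig.negReflect U)) * F₂ U * W U)) μ :=
    (i21.const_mul _).add (i22.const_mul _)
  calc ∫ U, conj (F₁ (GaugeConfig.negReflect U) + t * F₂ (GaugeConfig.negReflect U)) * (F₁ U + t * F₂ U) * W U ∂μ
      = ∫ U, (conj (F₁ (GaugeConfig.negReflect U)) * F₁ U * W U + t * (conj (F₁ (GaugeConfig.negReflect U)) * F₂ U * W U)) +
          (conj t * (conj (F₂ (GaugeConfig.negReflect U)) * F₁ U * W U) +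
            conj t * t * (conj (F₂ (GaugeConfig.negReflect U)) * F₂ U * W U)) ∂μ := by
        refine integral_congr_ae (ae_of_all _ fun U => ?_)
        simp only [map_add, map_mul]
        ring
    _ = (∫ U, conj (F₁ (GaugeConfig.negReflect U)) * F₁ U * W U ∂μ +
          t * ∫ U, conj (F₁ (GaugeConfig.negReflect U)) * F₂ U * W U ∂μ) +
        (conj t * ∫ U, conj (F₂ (GaugeConfig.negReflect U)) * F₁ U * W U ∂μ +
          conj t * t * ∫ U, conj (F₂ (GaugeConfig.negReflect U)) * F₂ U * W U ∂μ) := by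
        rw [integral_add iA iB, integral_add i11 (i12.const_mul t),
          integral_add (i21.const_mul _) (i22.const_mul _), integral_const_mul, integral_const_mul,
          integral_const_mul]
    _ = _ := by ring

end Generic

section MainGeneric

/-- **Cauchy–Schwarz for the form** from positivity on half-observables and Hermitian symmetry:
`(Re B(F₁, F₂))² ≤ |B(F₁, F₂)|² ≤ Re B(F₁, F₁) · Re B(F₂, F₂)`. -/
theorem re_rpForm_sq_le {L : ℕ} [NeZero L] {G : Type*} [Group G] [TopologicalSpace G]
    [IsTopologicalGroup G] [CompactSpace G] [MeasurableSpace G] [BorelSpace G]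
    {W : GaugeConfig 4 L G → ℂ} (hWm : Measurable W)
    (hWb : ∃ C, ∀ U, ‖W U‖ ≤ C) (hWr : ∀ U, conj (W U) = W U) (hWΘ : ∀ U, W (GaugeConfig.negReflect U) = W U)
    (hpos : ∀ F : GaugeConfig 4 L G → ℂ, WilsonSiteRP.IsHalfObs F →
      0 ≤ ∫ U, conj (F (GaugeConfig.negReflect U)) * F U * W U ∂(Measure.pi fun _ : Edge 4 L => haarProbability G))
    {F₁ F₂ : GaugeConfig 4 L G → ℂ} (h₁ : WilsonSiteRP.IsHalfObs F₁) (h₂ : WilsonSiteRP.IsHalfObs F₂) :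
    (∫ U, conj (F₁ (GaugeConfig.negReflect U)) * F₂ U * W U ∂(Measure.pi fun _ : Edge 4 L => haarProbability G)).re ^ 2 ≤
      (∫ U, conj (F₁ (GaugeConfig.negReflect U)) * F₁ U * W U ∂(Measure.pi fun _ : Edge 4 L => haarProbability G)).re *
      (∫ U, conj (F₂ (GaugeConfig.negReflect U)) * F₂ U * W U ∂(Measure.pi fun _ : Edge 4 L => haarProbability G)).re := by
  set μ : Measure (GaugeConfig 4 L G) := Measure.pi fun _ : Edge 4 L => haarProbability G
  set b : ℂ := ∫ U, conj (F₁ (GaugeConfig.negReflect U)) * F₂ U * W U ∂μ with hb_def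
  have ha := hpos F₁ h₁
  have hc := hpos F₂ h₂
  have hnorm : ‖b‖ ^ 2 ≤ (∫ U, conj (F₁ (GaugeConfig.negReflect U)) * F₁ U * W U ∂μ).re *
      (∫ U, conj (F₂ (GaugeConfig.negReflect U)) * F₂ U * W U ∂μ).re := by
    refine WilsonSiteRP.normSq_le_mul_of_forall_quadratic (Complex.nonneg_iff.1 ha).1
      (Complex.nonneg_iff.1 hc).1 fun t => ?_
    have hH := hpos _ (h₁.add_smul h₂ t)
    rw [asm_rpForm_add_smul hWm hWb h₁ h₂ t, asm_rpForm_conj_symm hWr hWΘ F₁ F₂] at hH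
    have hb : (conj t * conj b).re = (t * b).re := by
      rw [← map_mul, Complex.conj_re]
    have ht : (conj t * t).re = ‖t‖ ^ 2 := by
      rw [mul_comm, Complex.mul_conj, Complex.normSq_eq_norm_sq]; norm_cast
    have ht' : (conj t * t).im = 0 := by
      rw [mul_comm, Complex.mul_conj]; norm_cast
    have key : 0 ≤ (∫ U, conj (F₁ (GaugeConfig.negReflect U)) * F₁ U * W U ∂μ).re + (t * b).re +
        (conj t * conj b).re +
        ((conj t * t).re * (∫ U, conj (F₂ (GaugeConfig.negReflect U)) * F₂ U * W U ∂μ).re -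
          (conj t * t).im * (∫ U, conj (F₂ (GaugeConfig.negReflect U)) * F₂ U * W U ∂μ).im) := by
      have := (Complex.nonneg_iff.1 hH).1
      simpa only [Complex.add_re, Complex.mul_re] using this
    rw [hb, ht, ht', zero_mul, sub_zero] at key
    linarith
  have h := abs_le.1 (Complex.abs_re_le_norm b)
  exact (sq_le_sq' h.1 h.2).trans hnorm

end MainGeneric

/-! ## The signed weight of `SU(3)` lattice QCD with antiperiodic Wilson quarks -/

section SU3

variable {L : ℕ} [NeZero L]

omit [NeZero L] in
/-- The matrix of the antiperiodic lift at a fixed link depends continuously on the field. -/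
theorem asm_continuous_coe_apLift (e : Edge 4 L) :
    Continuous fun U : GaugeConfig 4 L (Matrix.specialUnitaryGroup (Fin 3) ℂ) =>
      ((apLift U e : Matrix.unitaryGroup (Fin 3) ℂ) : Matrix (Fin 3) (Fin 3) ℂ) := by
  simp only [coe_apLift_apply]
  split_ifs
  · exact (continuous_subtype_val.comp (continuous_apply e)).neg
  · exact continuous_subtype_val.comp (continuous_apply e)

omit [NeZero L] in
/-- `U ↦ D_AP[U, m]` is continuous (entries are polynomials in the link matrix entries). -/
theorem asm_continuous_wilsonDiracAP (m : ℝ) :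
    Continuous fun U : GaugeConfig 4 L (Matrix.specialUnitaryGroup (Fin 3) ℂ) =>
      wilsonDiracAP (N := 3) U m := by
  refine continuous_pi fun p => continuous_pi fun q => ?_
  simp only [wilsonDiracAP_def, wilsonDirac, Matrix.of_apply, unitaryFundamentalRep_apply,
    Matrix.UnitaryGroup.inv_val]
  refine continuous_const.sub (continuous_const.mul (continuous_finsetSum _ fun μ _ => ?_))
  refine Continuous.add ?_ ?_
  · split_ifs
    · exact continuous_const.mul ((asm_continuous_coe_apLift _).matrix_elem _ _)
    · exact continuous_const
  · split_ifs
    · exact continuous_const.mul ((asm_continuous_coe_apLift _).star.matrix_elem _ _)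
    · exact continuous_const

/-- The Wilson action of `SU(3)` is continuous in the field. -/
theorem asm_continuous_wilsonAction_su3 :
    Continuous fun U : GaugeConfig 4 L (Matrix.specialUnitaryGroup (Fin 3) ℂ) =>
      wilsonAction (fundamentalRep (Fin 3)) U := by
  unfold wilsonAction plaquetteHolonomy
  refine continuous_finsetSum _ fun p _ => continuous_const.sub ?_
  refine (Complex.continuous_re.comp ?_)
  refine Continuous.matrix_trace ?_
  exact (continuous_fundamentalRep (Fin 3)).comp (by fun_prop)

/-- The signed weight `W(U) = ∏_f det D_AP[U, m_f] e^{-β S_W(U)}` is continuous. -/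
theorem asm_continuous_signedWeight (β : ℝ) {Nf : ℕ} (m : Fin Nf → ℝ) :
    Continuous fun U : GaugeConfig 4 L (Matrix.specialUnitaryGroup (Fin 3) ℂ) =>
      (∏ f, (wilsonDiracAP U (m f)).det) * (Real.exp (-β * wilsonAction (fundamentalRep (Fin 3)) U) : ℂ) := by
  have h1 : Continuous fun U : GaugeConfig 4 L (Matrix.specialUnitaryGroup (Fin 3) ℂ) =>
      ∏ f, (wilsonDiracAP (N := 3) U (m f)).det :=
    continuous_finsetProd _ fun f _ => (asm_continuous_wilsonDiracAP (m f)).matrix_det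
  have h2 : Continuous fun U : GaugeConfig 4 L (Matrix.specialUnitaryGroup (Fin 3) ℂ) =>
      (Real.exp (-β * wilsonAction (fundamentalRep (Fin 3)) U) : ℂ) :=
    Complex.continuous_ofReal.comp ((continuous_const.mul asm_continuous_wilsonAction_su3).rexp)
  exact h1.mul h2

/-- The signed weight is bounded (a continuous function on a compact space). -/
theorem asm_exists_norm_signedWeight_le (β : ℝ) {Nf : ℕ} (m : Fin Nf → ℝ) :
    ∃ C : ℝ, ∀ U : GaugeConfig 4 L (Matrix.specialUnitaryGroup (Fin 3) ℂ),
      ‖(∏ f, (wilsonDiracAP U (m f)).det) *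
        (Real.exp (-β * wilsonAction (fundamentalRep (Fin 3)) U) : ℂ)‖ ≤ C := by
  obtain ⟨U₀, -, hU₀⟩ := (isCompact_univ (X := GaugeConfig 4 L (Matrix.specialUnitaryGroup (Fin 3) ℂ))).exists_isMaxOn
    Set.univ_nonempty ((asm_continuous_signedWeight (L := L) β m).norm.continuousOn)
  exact ⟨_, fun U => hU₀ (Set.mem_univ U)⟩

/-- The signed weight is real. -/
theorem asm_conj_signedWeight (β : ℝ) {Nf : ℕ} (m : Fin Nf → ℝ)
    (U : GaugeConfig 4 L (Matrix.specialUnitaryGroup (Fin 3) ℂ)) :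
    conj ((∏ f, (wilsonDiracAP U (m f)).det) * (Real.exp (-β * wilsonAction (fundamentalRep (Fin 3)) U) : ℂ)) =
      (∏ f, (wilsonDiracAP U (m f)).det) * (Real.exp (-β * wilsonAction (fundamentalRep (Fin 3)) U) : ℂ) := by
  rw [map_mul, map_prod, Complex.conj_ofReal]
  congr 1
  exact Finset.prod_congr rfl fun f _ => star_fermionDet_wilsonDiracAP U (m f)

/-- The norm of the signed weight. -/
theorem asm_norm_signedWeight (β : ℝ) {Nf : ℕ} (m : Fin Nf → ℝ)
    (U : GaugeConfig 4 L (Matrix.specialUnitaryGroup (Fin 3) ℂ)) :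
    ‖(∏ f, (wilsonDiracAP U (m f)).det) * (Real.exp (-β * wilsonAction (fundamentalRep (Fin 3)) U) : ℂ)‖ =
      (∏ f, ‖(wilsonDiracAP U (m f)).det‖) * Real.exp (-β * wilsonAction (fundamentalRep (Fin 3)) U) := by
  rw [norm_mul, norm_prod, Complex.norm_real, Real.norm_eq_abs, abs_of_pos (Real.exp_pos _)]

omit [NeZero L] in
/-- The site reflection `Θ'` of the tree (`GaugeConfig.negReflect`) is the site reflection
`Θ(τ_{ê₀} U)` of `WilsonDiracAP`/`TorusSiteRP`. -/
theorem asm_siteReflect_eq_negReflect (U : GaugeConfig 4 L (Matrix.specialUnitaryGroup (Fin 3) ℂ)) :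
    (torusConfigShift (Pi.single (0 : Fin 4) (1 : ZMod L)) U).timeReflect = U.negReflect := by
  funext e
  rw [siteReflect_apply']
  rfl

/-- `det D_AP` is invariant under `Θ'`. -/
theorem asm_det_wilsonDiracAP_negReflect (U : GaugeConfig 4 L (Matrix.specialUnitaryGroup (Fin 3) ℂ))
    (m : ℝ) : (wilsonDiracAP (N := 3) U.negReflect m).det = (wilsonDiracAP U m).det := by
  rw [← asm_siteReflect_eq_negReflect]
  exact fermionDet_wilsonDiracAP_siteReflect U m

/-- The signed weight is invariant under `Θ'` (even `L`). -/
theorem asm_signedWeight_negReflect (hL : Even L) (β : ℝ) {Nf : ℕ} (m : Fin Nf → ℝ)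
    (U : GaugeConfig 4 L (Matrix.specialUnitaryGroup (Fin 3) ℂ)) :
    (∏ f, (wilsonDiracAP U.negReflect (m f)).det) *
        (Real.exp (-β * wilsonAction (fundamentalRep (Fin 3)) U.negReflect) : ℂ) =
      (∏ f, (wilsonDiracAP U (m f)).det) * (Real.exp (-β * wilsonAction (fundamentalRep (Fin 3)) U) : ℂ) := by
  haveI : Fact (1 < L) := ⟨by obtain ⟨r, hr⟩ := hL; have := NeZero.ne L; omega⟩
  rw [WilsonSiteRP.wilsonAction_negReflect (fundamentalRep (Fin 3)) hL (continuous_fundamentalRep (Fin 3))]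
  congr 1
  exact Finset.prod_congr rfl fun f _ => asm_det_wilsonDiracAP_negReflect U (m f)

/-- The signed weight is translation invariant. -/
theorem asm_signedWeight_torusConfigShift (β : ℝ) {Nf : ℕ} (m : Fin Nf → ℝ) (v : Site 4 L)
    (U : GaugeConfig 4 L (Matrix.specialUnitaryGroup (Fin 3) ℂ)) :
    (∏ f, (wilsonDiracAP (torusConfigShift v U) (m f)).det) *
        (Real.exp (-β * wilsonAction (fundamentalRep (Fin 3)) (torusConfigShift v U)) : ℂ) =
      (∏ f, (wilsonDiracAP U (m f)).det) * (Real.exp (-β * wilsonAction (fundamentalRep (Fin 3)) U) : ℂ) := by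
  rw [wilsonAction_torusConfigShift]
  congr 1
  exact Finset.prod_congr rfl fun f _ => fermionDet_wilsonDiracAP_torusConfigShift v U (m f)

end SU3

end Summit.QuantumFields.QCD.Theorems.UnquenchedChessboardBoundLine

end
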